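import Summits.ResolutionOfSingularities.ResolutionOfSingularities.Theorems.PurelyInseparableDim4AtlasCertComputations
import Summits.ResolutionOfSingularities.ResolutionOfSingularities.Theorems.PurelyInseparableDim4AtlasMemberDefs
import HarnessLib

/-!
# Purely inseparable four-folds: the CHARTS of the escaping-child certificate — equimultiple classification, dead second charts, states
# (brick S3 (c) v4, tranche 1, brick A6-charts; cell `res-dim4-pi`)

[OURS · counted 0] (D-0157 DOOR 2; host item stmt-ResolutionOfSingularities-16155, helper). Nothing here proves resolution of
singularities in dimension ≥ 4 / characteristic `p`. For `F = x₁^{2p} x₄ + x₂^{2p} x₃ + x₁ x₂^{p−1} x₃^p` (`p ≥ 3`), root centre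
`V(z, x₁, x₂)`: the origin of chart `x₁` is equimultiple (the entry `(0, 0, {0,2})`); every normalised equimultiple pair of chart `x₁` / of
chart `x₂` has `b₃ = 0` (lies on the escaping child `{y₃ = 0} × ℙ¹`); the main reading's state is `F₀`, the extra reading's is `F₁`; and
all four charts of the child's blow-up are DEAD (no equimultiple pairs at all).

AI-produced formalisation, weaker than expert review. bears_on: LADDER-RESOLUTION:D157-DOOR2 (res-dim4-pi · S3 (c) v4 A6 charts).
-/

set_option linter.dupNamespace false -- D-0017: single-problem summit path `Summit.<S>.<S>.…` by design

noncomputable section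

open MvPolynomial Finset

namespace Summit.ResolutionOfSingularities.ResolutionOfSingularities.Theorems.PIDim4

open Literature.AlgebraicGeometry.Resolution
open Literature.AlgebraicGeometry.Resolution.Hauser2010

namespace Equimultiple

section ACertCharts

variable {K : Type} [Field K] {p : ℕ} [hp : Fact p.Prime] [CharP K p]

/-! ## §1 The root's charts -/

omit [CharP K p] in
/-- **The entry point is equimultiple**: at `b = 0` every monomial of `F₀` has degree `≥ p`. [cite: Hauser2010, §F (equiconstant points)] -/
theorem isEquimultiplePoint_S0_zero_acert [DecidableEq K] (hp3 : 3 ≤ p) (s : State K)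
    (hs : s.F = X 0 ^ (2 * p) * X 3 + X 1 ^ (2 * p) * X 2 + X 0 * X 1 ^ (p - 1) * X 2 ^ p) :
    CentreBlowup.IsEquimultiplePoint p ({0, 1} : Finset (Fin 4)) 0 (0 : Fin 4 → K) s := by
  intro d hd0 hdeg
  unfold CentreBlowup.pointTransform
  rw [hs, chartTransform_S0_acert, PointBlowup.translate_zero]
  by_contra hne
  rcases mem_support_three (mem_support_iff.mpr hne) with rfl | rfl | rfl <;> rw [Rescue.BedSlopeResidual.degree_E4] at hdeg <;> omega

omit [CharP K p] in
/-- **Chart `x₁`: the normalised equimultiple pairs lie on the child** (`b₁ = 0 ⇒ b₃ = 0`; the coefficient of `y₂^{p−1}` is `b₃^p`).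
[cite: Hauser2010, §F (equiconstant points)] -/
theorem eq_zero_of_isEquimultiplePoint_S0_acert [DecidableEq K] (hp3 : 3 ≤ p) {b : Fin 4 → K} (s : State K)
    (hs : s.F = X 0 ^ (2 * p) * X 3 + X 1 ^ (2 * p) * X 2 + X 0 * X 1 ^ (p - 1) * X 2 ^ p)
    (h : CentreBlowup.IsEquimultiplePoint p ({0, 1} : Finset (Fin 4)) 0 b s) (hb : b 0 = 0) : b 2 = 0 := by
  have hp0 : p ≠ 0 := hp.out.ne_zero
  unfold CentreBlowup.IsEquimultiplePoint CentreBlowup.pointTransform at h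
  rw [hs, chartTransform_S0_acert] at h
  have hc := h (Finsupp.single 0 0 + Finsupp.single 1 (p - 1) + Finsupp.single 2 0 + Finsupp.single 3 0)
    (fun he => by have := DFunLike.congr_fun he 1; simp at this; omega) (by rw [Rescue.BedSlopeResidual.degree_E4]; omega)
  rw [Rescue.BedMohRiseQ4TopLocus.translate_add, Rescue.BedMohRiseQ4TopLocus.translate_add, coeff_add, coeff_add,
    coeff_translate_four, coeff_translate_four, coeff_translate_four, hb, Nat.choose_eq_zero_of_lt (show 0 < p - 1 by omega)] at hc
  simp [zero_pow hp0] at hc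
  exact hc.1

omit [CharP K p] in
/-- **Chart `x₂`: the normalised OWNED equimultiple pairs lie on the child** (`b₁ = b₂ = 0 ⇒ b₃ = 0`; the coefficient of `y₁` is `b₃^p`).
[cite: Hauser2010, §F (equiconstant points)] -/
theorem eq_zero_of_isEquimultiplePoint_S1_acert [DecidableEq K] (hp3 : 3 ≤ p) {b : Fin 4 → K} (s : State K)
    (hs : s.F = X 0 ^ (2 * p) * X 3 + X 1 ^ (2 * p) * X 2 + X 0 * X 1 ^ (p - 1) * X 2 ^ p)
    (h : CentreBlowup.IsEquimultiplePoint p ({0, 1} : Finset (Fin 4)) 1 b s) (hb0 : b 0 = 0) (hb1 : b 1 = 0) : b 2 = 0 := by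
  have hp0 : p ≠ 0 := hp.out.ne_zero
  unfold CentreBlowup.IsEquimultiplePoint CentreBlowup.pointTransform at h
  rw [hs, chartTransform_S1_acert] at h
  have hc := h (Finsupp.single 0 1 + Finsupp.single 1 0 + Finsupp.single 2 0 + Finsupp.single 3 0)
    (fun he => by have := DFunLike.congr_fun he 0; simp at this) (by rw [Rescue.BedSlopeResidual.degree_E4]; omega)
  rw [Rescue.BedMohRiseQ4TopLocus.translate_add, Rescue.BedMohRiseQ4TopLocus.translate_add, coeff_add, coeff_add,
    coeff_translate_four, coeff_translate_four, coeff_translate_four, hb0, hb1, Nat.choose_eq_zero_of_lt (show 0 < 1 by omega)] at hc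
  simp [zero_pow hp0] at hc
  exact hc.1

omit [CharP K p] in
/-- **The main reading's state is `F₀`.** [cite: HauserPerlega2019PRIMS, §2 (cleaning)] -/
theorem step_S0_acert [DecidableEq K] (s : State K)
    (hs : s.F = X 0 ^ (2 * p) * X 3 + X 1 ^ (2 * p) * X 2 + X 0 * X 1 ^ (p - 1) * X 2 ^ p) :
    (CentreBlowup.step p ({0, 1} : Finset (Fin 4)) 0 (0 : Fin 4 → K) s).F =
      C 1 * (X 0 ^ p * X 1 ^ 0 * X 2 ^ 0 * X 3 ^ 1) + C 1 * (X 0 ^ p * X 1 ^ (2 * p) * X 2 ^ 1 * X 3 ^ 0) +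
        C 1 * (X 0 ^ 0 * X 1 ^ (p - 1) * X 2 ^ p * X 3 ^ 0) := by
  show deletePthPowers p (PointBlowup.translate (0 : Fin 4 → K)
    (CentreBlowup.chartTransform p ({0, 1} : Finset (Fin 4)) 0 s.F)) = _
  rw [hs, chartTransform_S0_acert, PointBlowup.translate_zero]
  exact Literature.Barriers.ResolutionOfSingularities.HauserPerlega.deletePthPowers_eq_self (isClean_F0_acert hp.out.two_le)

omit [CharP K p] in
/-- **The extra reading's state is `F₁`.** [cite: HauserPerlega2019PRIMS, §2 (cleaning)] -/
theorem escState_S1_acert [DecidableEq K] (s : State K)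
    (hs : s.F = X 0 ^ (2 * p) * X 3 + X 1 ^ (2 * p) * X 2 + X 0 * X 1 ^ (p - 1) * X 2 ^ p) :
    (escState p ({0, 1} : Finset (Fin 4)) 1 (0 : Fin 4 → K) s).F =
      C 1 * (X 0 ^ (2 * p) * X 1 ^ p * X 2 ^ 0 * X 3 ^ 1) + C 1 * (X 0 ^ 0 * X 1 ^ p * X 2 ^ 1 * X 3 ^ 0) +
        C 1 * (X 0 ^ 1 * X 1 ^ 0 * X 2 ^ p * X 3 ^ 0) := by
  show deletePthPowers p (PointBlowup.translate (0 : Fin 4 → K)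
    (CentreBlowup.chartTransform p ({0, 1} : Finset (Fin 4)) 1 s.F)) = _
  rw [hs, chartTransform_S1_acert, PointBlowup.translate_zero]
  exact Literature.Barriers.ResolutionOfSingularities.HauserPerlega.deletePthPowers_eq_self (isClean_F1_acert hp.out.two_le)

/-! ## §2 The child's charts are dead -/

omit [CharP K p] in
/-- **Chart `{0,2}`/`y₁` of `F₀` is DEAD**: `∂₄ = 1`. [cite: Hauser2010, §F (equiconstant points)] -/
theorem not_isEquimultiplePoint_T0_acert [DecidableEq K] {b : Fin 4 → K} (s : State K)
    (hs : s.F = C 1 * (X 0 ^ p * X 1 ^ 0 * X 2 ^ 0 * X 3 ^ 1) + C 1 * (X 0 ^ p * X 1 ^ (2 * p) * X 2 ^ 1 * X 3 ^ 0) +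
        C 1 * (X 0 ^ 0 * X 1 ^ (p - 1) * X 2 ^ p * X 3 ^ 0)) :
    ¬ CentreBlowup.IsEquimultiplePoint p ({0, 2} : Finset (Fin 4)) 0 b s := by
  intro h
  unfold CentreBlowup.IsEquimultiplePoint CentreBlowup.pointTransform at h
  rw [hs, chartTransform_T0_acert] at h
  have h3 := eval_pderiv_eq_zero_of_forall_coeff b _ h 3
  simp [(pderiv (3 : Fin 4)).leibniz_pow] at h3

/-- **Chart `{0,2}`/`y₃` of `F₀` is DEAD**: `∂₂ = (p−1) y₂^{p−2}` off `y₂ = 0`, and the coefficient of `y₂^{p−1}` is `1` on it.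
[cite: Hauser2010, §F (equiconstant points)] -/
theorem not_isEquimultiplePoint_T2_acert [DecidableEq K] (hp3 : 3 ≤ p) {b : Fin 4 → K} (s : State K)
    (hs : s.F = C 1 * (X 0 ^ p * X 1 ^ 0 * X 2 ^ 0 * X 3 ^ 1) + C 1 * (X 0 ^ p * X 1 ^ (2 * p) * X 2 ^ 1 * X 3 ^ 0) +
        C 1 * (X 0 ^ 0 * X 1 ^ (p - 1) * X 2 ^ p * X 3 ^ 0)) :
    ¬ CentreBlowup.IsEquimultiplePoint p ({0, 2} : Finset (Fin 4)) 2 b s := by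
  have hp0 : p ≠ 0 := hp.out.ne_zero
  have hpK : (p : K) = 0 := CharP.cast_eq_zero K p
  intro h
  unfold CentreBlowup.IsEquimultiplePoint CentreBlowup.pointTransform at h
  rw [hs, chartTransform_T2_acert] at h
  by_cases hb1 : b 1 = 0
  · have hc := h (Finsupp.single 0 0 + Finsupp.single 1 (p - 1) + Finsupp.single 2 0 + Finsupp.single 3 0)
      (fun he => by have := DFunLike.congr_fun he 1; simp at this; omega) (by rw [Rescue.BedSlopeResidual.degree_E4]; omega)
    rw [Rescue.BedMohRiseQ4TopLocus.translate_add, Rescue.BedMohRiseQ4TopLocus.translate_add, coeff_add, coeff_add,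
      coeff_translate_four, coeff_translate_four, coeff_translate_four, hb1,
      Nat.choose_eq_zero_of_lt (show 0 < p - 1 by omega)] at hc
    simp [zero_pow (show 2 * p - (p - 1) ≠ 0 by omega)] at hc
  · have h1 := eval_pderiv_eq_zero_of_forall_coeff b _ h 1
    simp [(pderiv (1 : Fin 4)).leibniz_pow] at h1
    have hpm1 : ((p - 1 : ℕ) : K) ≠ 0 := by
      rw [Ne, CharP.cast_eq_zero_iff K p]
      exact fun hd => absurd (Nat.le_of_dvd (by omega) hd) (by omega)
    rcases h1 with h1 | h1
    · exact hpm1 h1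
    · first | exact hb1 h1 | exact hb1 h1.1

omit [CharP K p] in
/-- **Chart `{1,2}`/`y₂` of `F₁` is DEAD**: the coefficient of `y₂ y₃` is `1` (`p ≥ 3`). [cite: Hauser2010, §F (equiconstant points)] -/
theorem not_isEquimultiplePoint_R1_acert [DecidableEq K] (hp3 : 3 ≤ p) {b : Fin 4 → K} (s : State K)
    (hs : s.F = C 1 * (X 0 ^ (2 * p) * X 1 ^ p * X 2 ^ 0 * X 3 ^ 1) + C 1 * (X 0 ^ 0 * X 1 ^ p * X 2 ^ 1 * X 3 ^ 0) +
        C 1 * (X 0 ^ 1 * X 1 ^ 0 * X 2 ^ p * X 3 ^ 0)) :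
    ¬ CentreBlowup.IsEquimultiplePoint p ({1, 2} : Finset (Fin 4)) 1 b s := by
  have hp0 : p ≠ 0 := hp.out.ne_zero
  intro h
  unfold CentreBlowup.IsEquimultiplePoint CentreBlowup.pointTransform at h
  rw [hs, chartTransform_R1_acert] at h
  have hc := h (Finsupp.single 0 0 + Finsupp.single 1 1 + Finsupp.single 2 1 + Finsupp.single 3 0)
    (fun he => by have := DFunLike.congr_fun he 1; simp at this) (by rw [Rescue.BedSlopeResidual.degree_E4]; omega)
  rw [Rescue.BedMohRiseQ4TopLocus.translate_add, Rescue.BedMohRiseQ4TopLocus.translate_add, coeff_add, coeff_add,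
    coeff_translate_four, coeff_translate_four, coeff_translate_four,
    Nat.choose_eq_zero_of_lt (show 0 < 1 by omega)] at hc
  simp at hc

/-- **Chart `{1,2}`/`y₃` of `F₁` is DEAD**: `∂₁ = 1 + 2p·… = 1`. [cite: Hauser2010, §F (equiconstant points)] -/
theorem not_isEquimultiplePoint_R2_acert [DecidableEq K] {b : Fin 4 → K} (s : State K)
    (hs : s.F = C 1 * (X 0 ^ (2 * p) * X 1 ^ p * X 2 ^ 0 * X 3 ^ 1) + C 1 * (X 0 ^ 0 * X 1 ^ p * X 2 ^ 1 * X 3 ^ 0) +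
        C 1 * (X 0 ^ 1 * X 1 ^ 0 * X 2 ^ p * X 3 ^ 0)) :
    ¬ CentreBlowup.IsEquimultiplePoint p ({1, 2} : Finset (Fin 4)) 2 b s := by
  have hpK : (p : K) = 0 := CharP.cast_eq_zero K p
  intro h
  unfold CentreBlowup.IsEquimultiplePoint CentreBlowup.pointTransform at h
  rw [hs, chartTransform_R2_acert] at h
  have h0 := eval_pderiv_eq_zero_of_forall_coeff b _ h 0
  simp [(pderiv (0 : Fin 4)).leibniz_pow] at h0

end ACertCharts

end Equimultiple

end Summit.ResolutionOfSingularities.ResolutionOfSingularities.Theorems.PIDim4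

end
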